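import Literature.AlgebraicGeometry.Frobenioids.MonoidTransport
import Literature.AnabelianGeometry.EtaleTheta.TemperedFrobenioid
import HarnessLib

/-!
# [EtTh] Remark 3.6.6: for a PERFECT divisor monoid `Φ`, condition (a) of Definition 3.6 (ii)
# («`Φ^{bs-fld}(A)` is monoprime») follows from `Φ^{bs-fld}(A) ≠ 0` — PROVED at print's divisorial
# reading (Λ-rational prime coordinates), with the coordinate chart DISPLAYED as the binder of the
# abstract Def. 3.6 (i)/(ii) record (proof-only)

S. Mochizuki, *The étale theta function and its Frobenioid-theoretic manifestations*, Publ. RIMS **45**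
(2009) [MochizukiEtTh2009], §3, Remark 3.6.6, PRIMS PDF p. 79 l. 20–24 (printed p. 305): «In the situation
of Definition 3.6, (ii), if one supposes further that `Φ` is perfect, then condition (a) follows from
condition (b) [or, alternatively, from the condition that `Φ^{bs-fld}(A)` be nonzero for each
`A ∈ Ob(D)`].  Indeed, this follows immediately by applying the factorization homomorphism of [Mzk17],
Definition 2.4, (i), (c) [cf. also [Mzk17], Definition 2.4, (i), (d)], associated to the perf-factorial
monoid `Φ(A)`.» [cite: MochizukiEtTh2009, Rmk 3.6.6 p.79]; [FrdI] §0 p. 10 (monoprime = `Λ`-monoprime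
for some `Λ ∈ {ℤ, ℚ, ℝ}`, the tree's `Frobenioids.IsMonoprime`), Def. 2.4 (i)(c)(d) p. 47 (the
factorization homomorphism: a perf-factorial monoid is read prime by prime, with `Λ_𝔭`-valued coordinates,
`M_𝔭 ≅ Λ_{𝔭,≥0}`) [cite: MochizukiFrdI2008, Def. 2.4(i) p.47].

PROOF-ONLY (theorems only: no `def`, no instance, no `Prop` fact; sets enter through membership
hypotheses).  abc-iut cell, layer L2, seat abc-iut-L2-t6 gen 13, row «RMK366-PERFECT-MONOPRIME» (L2 ROWS #142
R1158 (6); abc-iut-w6-d076's sizing of 2026-08-27T04:11:44Z as spec).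

WHAT PRINT'S PROOF IS.  Through the factorization homomorphism a perfect perf-factorial `Φ(A)` is a monoid
of functions `𝔭 ↦ x_𝔭 ∈ Λ_{𝔭,≥0}` on its primes, `Λ_𝔭 ∈ {ℚ, ℝ}` (perfect ⇒ no `ℤ`-type prime), and
`Φ^{bs-fld}(A) = Φ(A) ∩ ℝ·Φ₀^cnst` consists of the `x` on the RAY `ℝ_{≥0}·d` of the log-divisor `d` of a
constant.  Hence `Φ^{bs-fld}(A) ≅ S(d) := {t ∈ ℝ_{≥0} | t·d_𝔭 ∈ ℚ for every ℚ-type 𝔭}`, which is EXACTLY ONE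
OF `{0}` (two `ℚ`-type primes with incommensurable `d_𝔭`), `ℚ_{≥0}·t₀ ≅ ℚ_{≥0}`, `ℝ_{≥0}` (no `ℚ`-type
prime in the support of `d`) — so «`Φ^{bs-fld}(A) ≠ 0 ⇒` monoprime».  Typed:
* `Rmk366.scalars_eq_top` / `isRMonoprime_scalars` / `isQMonoprime_scalars` / **`isMonoprime_scalars`** —
  the trichotomy of the scalar monoid (any index type, `ℚ`-type predicate `q`, direction `d`);
* **`Rmk366.isMonoprime_of_coordinates`** — print's reading at ANY commutative monoid `N ⊇ Φ ⊇ P` with an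
  injective coordinate homomorphism `c : N → (ι → ℝ_{≥0})` ([FrdI] Def. 2.4 (i)(c)) in which `Φ` is
  `ℚ`-rational at the `q`-indices, `P = Φ ∩ ℝ_{≥0}·d`, the ray lies in `N` and its `ℚ`-rational points lie in
  `Φ` ([FrdI] Def. 2.4 (i)(d) + the group-saturation of [EtTh] Def. 3.6 (ii)): `P ≠ ⊥ ⇒ IsMonoprime P`;
* **`TemperedFrobenioid.Rmk366.isMonoprime_bsFld_of_coordinates`** (′) — the same over the data of [EtTh]
  Def. 3.6 (i)/(ii) WITHOUT field (a) (`T : RealifiedDivisorMonoids V`, `base : D ⥤ D₀`, `Φ ⊆ Φ^{ℝ-log}`,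
  `A`), in a chart of `Φ^{ℝ-log}(A)` where `ℝ·Φ₀^cnst` cuts out the ray: conclusion = the TYPE OF THE
  RECORD'S FIELD `TemperedFrobenioid.isMonoprime_bsFld A` verbatim (resp. `IsMonoprime ↥(C.bsFld.carrier A)`).

HONEST LABEL.  Print's bracketed hypothesis «`Φ^{bs-fld}(A) ≠ 0`» is the one used; print's (b)
(«`F(A) → (Φ^{bs-fld})^gp(A)` nonzero») reaches it by one more coordinate step (a nonzero `x/y` on the LINE
has `x/y` or `y/x` on the ray, in `Φ(A)` by group-saturation) and is not typed (the record's (b),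
`exists_FΛ_div_ne`, only places `x, y` in `Φ(A)`).  Over the ABSTRACT record — `ℝ·Φ₀^cnst` an arbitrary
root-closed subgroup `cnstR` of `(Φ^{ℝ-log})^gp` — the remark's universal closure has the counter-shape
`Φ(A) = Φ^{ℝ-log}(A) = ℝ_{≥0}²`, `cnstR = ⊤` (perfect, perf-factorial, group-saturated; `Φ^{bs-fld}(A) = ℝ_{≥0}²`
not monoprime; not typed here), so field (a) is NOT redundant at interface level: print's «immediately»
uses that `ℝ·Φ₀^cnst` is a LINE in the SAME prime coordinates in which `Φ(A)` is `Λ`-rational — the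
chart `c, hΦ, hline, hray, hsat` displayed below (a theorem at explicit divisor-monoid models, [FrdI] Thm.
5.2 (i); over `treeMonoidVocab` the dictionary between `IsPerfFactorial.factorHom` of `Φ(A)` and `cnstR`,
not in the tree).  Refereed pre-IUT material; no consumer in the [IUTchIII] Cor. 3.12 cone; nothing here
bears on [IUTchIII] Cor. 3.12; no side taken.
-/

namespace Literature.AnabelianGeometry.EtaleTheta

open CategoryTheory Opposite Literature.AlgebraicGeometry.Frobenioids
open scoped NNReal

universe u₀ v₀ u v w

namespace Rmk366

section Scalars

variable {ι : Type*} {q : ι → Prop} {d : ι → ℝ≥0} {S : Submonoid (Multiplicative ℝ≥0)}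
  (hS : ∀ t : Multiplicative ℝ≥0, t ∈ S ↔ ∀ i, q i → ∃ r : ℚ≥0, (r : ℝ≥0) = Multiplicative.toAdd t * d i)
include hS

/-- The scalar monoid `S(d) = {t ∈ ℝ_{≥0} | t·d_i ∈ ℚ for every ℚ-type index i}` (membership hypothesis
`hS`): if the direction `d` vanishes at every `ℚ`-type index, every scalar is admissible, `S(d) = ℝ_{≥0}`
(print: no `ℚ`-type prime in the support of the constant log-divisor). [cite: MochizukiEtTh2009, Rmk 3.6.6 p.79] -/
theorem scalars_eq_top (h0 : ∀ i, q i → d i = 0) : S = ⊤ := by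
  refine top_le_iff.mp fun t _ => (hS t).mpr fun i hi => ⟨0, ?_⟩
  rw [h0 i hi, mul_zero, NNRat.cast_zero]

/-- In that case `S(d)` is `ℝ`-monoprime. [cite: MochizukiEtTh2009, Rmk 3.6.6 p.79] -/
theorem isRMonoprime_scalars (h0 : ∀ i, q i → d i = 0) : IsRMonoprime S :=
  ⟨⟨(MulEquiv.submonoidCongr (scalars_eq_top hS h0)).trans Submonoid.topEquiv⟩⟩

/-- If some `ℚ`-type index `i₀` has `d_{i₀} ≠ 0` and `S(d)` has a nonzero element `t₀`, then
`S(d) = ℚ_{≥0}·t₀ ≅ ℚ_{≥0}` is `ℚ`-monoprime: for `t ∈ S(d)` the ratio `t/t₀ = (t d_{i₀})/(t₀ d_{i₀})` is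
rational, and conversely rational multiples of `t₀` are admissible (print: the factorization homomorphism at a
`ℚ`-type prime). [cite: MochizukiEtTh2009, Rmk 3.6.6 p.79] -/
theorem isQMonoprime_scalars {i₀ : ι} (hq : q i₀) (hd : d i₀ ≠ 0) {t₀ : Multiplicative ℝ≥0} (ht₀ : t₀ ∈ S)
    (ht₀' : t₀ ≠ 1) : IsQMonoprime S := by
  have ha : Multiplicative.toAdd t₀ ≠ 0 := fun h => ht₀' (Multiplicative.toAdd.injective h)
  -- `r ↦ r · t₀`, `ℚ_{≥0} → ℝ_{≥0}`, as a multiplicative homomorphism into `S`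
  let φ : Multiplicative ℚ≥0 →* Multiplicative ℝ≥0 :=
    { toFun := fun r =>
        Multiplicative.ofAdd (((Multiplicative.toAdd r : ℚ≥0) : ℝ≥0) * Multiplicative.toAdd t₀)
      map_one' := by
        change Multiplicative.ofAdd (((0 : ℚ≥0) : ℝ≥0) * Multiplicative.toAdd t₀) = 1
        rw [NNRat.cast_zero, zero_mul]; rfl
      map_mul' := fun r r' => by
        change Multiplicative.ofAdd
          (((Multiplicative.toAdd r + Multiplicative.toAdd r' : ℚ≥0) : ℝ≥0) * Multiplicative.toAdd t₀) = _
        rw [NNRat.cast_add, add_mul, ofAdd_add] }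
  have hφ : ∀ r, Multiplicative.toAdd (φ r) =
      ((Multiplicative.toAdd r : ℚ≥0) : ℝ≥0) * Multiplicative.toAdd t₀ := fun r => rfl
  -- the coordinate of `t₀` at `i₀` is a nonzero rational `r₀`
  obtain ⟨r₀, hr₀⟩ := (hS t₀).mp ht₀ i₀ hq
  have hr₀' : (r₀ : ℝ≥0) ≠ 0 := by rw [hr₀]; exact mul_ne_zero ha hd
  have hφS : ∀ r, φ r ∈ S := fun r => (hS _).mpr fun i hi => by
    obtain ⟨rᵢ, hrᵢ⟩ := (hS t₀).mp ht₀ i hi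
    exact ⟨Multiplicative.toAdd r * rᵢ, by rw [NNRat.cast_mul, hrᵢ, hφ, mul_assoc]⟩
  let ψ : Multiplicative ℚ≥0 →* S := φ.codRestrict S hφS
  have hinj : Function.Injective ψ := fun r r' h => by
    have h1 : Multiplicative.toAdd (φ r) = Multiplicative.toAdd (φ r') :=
      congrArg (fun s : S => Multiplicative.toAdd (s : Multiplicative ℝ≥0)) h
    rw [hφ, hφ] at h1
    exact Multiplicative.toAdd.injective (NNRat.cast_injective (mul_right_cancel₀ ha h1))
  have hsurj : Function.Surjective ψ := by
    rintro ⟨t, ht⟩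
    obtain ⟨r, hr⟩ := (hS t).mp ht i₀ hq
    refine ⟨Multiplicative.ofAdd (r / r₀), Subtype.ext (Multiplicative.toAdd.injective ?_)⟩
    change Multiplicative.toAdd (φ _) = Multiplicative.toAdd t
    rw [hφ, toAdd_ofAdd, NNRat.cast_div, hr, hr₀, mul_div_mul_right _ _ hd, div_mul_cancel₀ _ ha]
  exact ⟨⟨(MulEquiv.ofBijective ψ ⟨hinj, hsurj⟩).symm⟩⟩

/-- **Trichotomy of the scalar monoid**, the heart of Remark 3.6.6: a nonzero `S(d)` is monoprime
(`ℚ`-monoprime as soon as some `ℚ`-type index lies in the support of `d`, `ℝ`-monoprime otherwise).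
[cite: MochizukiEtTh2009, Rmk 3.6.6 p.79] -/
theorem isMonoprime_scalars (hne : S ≠ ⊥) : IsMonoprime S := by
  by_cases h : ∃ i, q i ∧ d i ≠ 0
  · obtain ⟨i₀, hq, hd⟩ := h
    obtain ⟨t₀, ht₀, ht₀'⟩ : ∃ t₀ ∈ S, t₀ ≠ 1 := by
      by_contra h'
      push Not at h'
      exact hne (S.eq_bot_iff_forall.mpr h')
    exact IsMonoprime.ofQ (isQMonoprime_scalars hS hq hd ht₀ ht₀')
  · push Not at h
    exact IsMonoprime.ofR (isRMonoprime_scalars hS h)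

end Scalars

section Coordinates

variable {N : Type*} [CommMonoid N] {ι : Type*} (q : ι → Prop) (d : ι → ℝ≥0)
  (c : N →* Multiplicative (ι → ℝ≥0)) (Φ P : Submonoid N)

/-- **Remark 3.6.6 at print's divisorial reading.**  Let `N` be a commutative monoid with an injective
coordinate homomorphism `c : N → (ι → ℝ_{≥0})` (the factorization homomorphism / explicit divisorial
description), `Φ ≤ N` a submonoid whose elements have `ℚ`-rational coordinates at the `ℚ`-type indices `q`
(a PERFECT perf-factorial monoid has only `ℚ`- and `ℝ`-type primes), `d` a direction (the log-divisor of a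
constant) whose ray `ℝ_{≥0}·d` lies in `N` (`hray`) and whose `ℚ`-rational points lie in `Φ` (`hsat`:
[FrdI] Def. 2.4 (i)(d) + group-saturation), and `P = Φ ∩ ℝ_{≥0}·d` (`hP`: this is `Φ^{bs-fld}(A)`).
Then `P ≠ 0 ⇒ P` is monoprime — via `P ≅ S(d)` and `isMonoprime_scalars`.
[cite: MochizukiEtTh2009, Rmk 3.6.6 p.79] -/
theorem isMonoprime_of_coordinates (hc : Function.Injective c)
    (hΦ : ∀ x ∈ Φ, ∀ i, q i → ∃ r : ℚ≥0, (r : ℝ≥0) = Multiplicative.toAdd (c x) i)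
    (hP : ∀ x : N, x ∈ P ↔ x ∈ Φ ∧ ∃ t : ℝ≥0, Multiplicative.toAdd (c x) = t • d)
    (hray : ∀ t : ℝ≥0, ∃ x : N, Multiplicative.toAdd (c x) = t • d)
    (hsat : ∀ (x : N) (t : ℝ≥0), Multiplicative.toAdd (c x) = t • d →
      (∀ i, q i → ∃ r : ℚ≥0, (r : ℝ≥0) = t * d i) → x ∈ Φ)
    (hne : P ≠ ⊥) : IsMonoprime P := by
  -- the direction is nonzero: otherwise `P = {1}`
  obtain ⟨i₁, hi₁⟩ : ∃ i₁, d i₁ ≠ 0 := by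
    by_contra h
    push Not at h
    refine hne (P.eq_bot_iff_forall.mpr fun x hx => hc (Multiplicative.toAdd.injective ?_))
    obtain ⟨-, t, ht⟩ := (hP x).mp hx
    rw [ht, show d = 0 from funext h, smul_zero, map_one]
    rfl
  -- the scalar monoid `S(d)`
  let S : Submonoid (Multiplicative ℝ≥0) :=
    { carrier := {t | ∀ i, q i → ∃ r : ℚ≥0, (r : ℝ≥0) = Multiplicative.toAdd t * d i}
      mul_mem' := fun {s t} hs ht i hi => by
        obtain ⟨r, hr⟩ := hs i hi
        obtain ⟨r', hr'⟩ := ht i hi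
        exact ⟨r + r', by rw [NNRat.cast_add, hr, hr', toAdd_mul, add_mul]⟩
      one_mem' := fun i _ => ⟨0, by rw [NNRat.cast_zero, toAdd_one, zero_mul]⟩ }
  have hS : ∀ t : Multiplicative ℝ≥0, t ∈ S ↔
      ∀ i, q i → ∃ r : ℚ≥0, (r : ℝ≥0) = Multiplicative.toAdd t * d i := fun t => Iff.rfl
  -- the scalar of a point of `P`, read off at the index `i₁`
  have hscalar : ∀ x ∈ P, ∀ t : ℝ≥0, Multiplicative.toAdd (c x) = t • d →
      Multiplicative.toAdd (c x) i₁ / d i₁ = t := by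
    intro x _ t ht
    rw [ht, Pi.smul_apply, smul_eq_mul, mul_div_cancel_right₀ _ hi₁]
  -- `x ↦ (c x)_{i₁} / d_{i₁}` as a homomorphism `P → ℝ_{≥0}`
  let ψ₀ : P →* Multiplicative ℝ≥0 :=
    { toFun := fun x => Multiplicative.ofAdd (Multiplicative.toAdd (c (x : N)) i₁ / d i₁)
      map_one' := by
        rw [P.coe_one, map_one]
        change Multiplicative.ofAdd ((0 : ℝ≥0) / d i₁) = 1
        rw [zero_div]; rfl
      map_mul' := fun x y => by
        rw [P.coe_mul, map_mul, toAdd_mul, Pi.add_apply, add_div, ofAdd_add] }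
  have hψ₀ : ∀ x : P, Multiplicative.toAdd (ψ₀ x) = Multiplicative.toAdd (c (x : N)) i₁ / d i₁ :=
    fun x => rfl
  have hψ₀S : ∀ x : P, ψ₀ x ∈ S := fun x => by  -- it lands in `S(d)`
    obtain ⟨hxΦ, t, ht⟩ := (hP x).mp x.2
    refine (hS _).mpr fun i hi => ?_
    obtain ⟨r, hr⟩ := hΦ x hxΦ i hi
    exact ⟨r, by rw [hψ₀, hscalar x x.2 t ht, hr, ht, Pi.smul_apply, smul_eq_mul]⟩
  let ψ : P →* S := ψ₀.codRestrict S hψ₀S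
  have hinj : Function.Injective ψ := by
    intro x y h
    have h1 : Multiplicative.toAdd (ψ₀ x) = Multiplicative.toAdd (ψ₀ y) :=
      congrArg (fun s : S => Multiplicative.toAdd (s : Multiplicative ℝ≥0)) h
    obtain ⟨-, tx, htx⟩ := (hP x).mp x.2
    obtain ⟨-, ty, hty⟩ := (hP y).mp y.2
    rw [hψ₀, hψ₀, hscalar x x.2 tx htx, hscalar y y.2 ty hty] at h1
    exact Subtype.ext (hc (Multiplicative.toAdd.injective (by rw [htx, hty, h1])))
  have hsurj : Function.Surjective ψ := by
    rintro ⟨t, ht⟩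
    obtain ⟨x, hx⟩ := hray (Multiplicative.toAdd t)
    have hxΦ : x ∈ Φ := hsat x _ hx ((hS t).mp ht)
    have hxP : x ∈ P := (hP x).mpr ⟨hxΦ, _, hx⟩
    refine ⟨⟨x, hxP⟩, Subtype.ext (Multiplicative.toAdd.injective ?_)⟩
    change Multiplicative.toAdd (ψ₀ ⟨x, hxP⟩) = Multiplicative.toAdd t
    rw [hψ₀, hscalar x hxP _ hx]
  let e : P ≃* S := MulEquiv.ofBijective ψ ⟨hinj, hsurj⟩
  have hSne : S ≠ ⊥ := by
    intro hS0
    apply hne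
    refine P.eq_bot_iff_forall.mpr fun x hx => ?_
    have h1 : ψ₀ ⟨x, hx⟩ = 1 := by
      have h1' : ψ₀ ⟨x, hx⟩ ∈ S := hψ₀S ⟨x, hx⟩
      rwa [hS0, Submonoid.mem_bot] at h1'
    have h2 : (⟨x, hx⟩ : P) = 1 :=
      hinj (Subtype.ext (by rw [map_one]; exact h1))
    exact congrArg Subtype.val h2
  -- transport along `e` (the two monoids live in different universes, so case by case)
  rcases isMonoprime_scalars hS hSne with ⟨⟨⟨f⟩⟩⟩ | ⟨⟨⟨f⟩⟩⟩ | ⟨⟨⟨f⟩⟩⟩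
  · exact .ofZ ⟨⟨e.trans f⟩⟩
  · exact .ofQ ⟨⟨e.trans f⟩⟩
  · exact .ofR ⟨⟨e.trans f⟩⟩

end Coordinates

end Rmk366

/-! ## The [EtTh] Def. 3.6 (i)/(ii) record without field (a) -/

namespace TemperedFrobenioid

namespace Rmk366

variable {D₀ : Type u₀} [Category.{v₀} D₀] {V : FrdIMonoidStub.{w}}
  (T : RealifiedDivisorMonoids (D₀ := D₀) V) {D : Type u} [Category.{v} D] (base : D ⥤ D₀)
  (Φ : SubMonoidOn (base.op ⋙ T.ΦR)) (A : Dᵒᵖ)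

/-- **Remark 3.6.6 for the data of Definition 3.6 (i)/(ii) without condition (a).**  For the realified data
`T`, `base : D ⥤ D₀`, a subfunctor in monoids `Φ ⊆ Φ^{ℝ-log} := Φ₀^ℝ|_D` and an object `A`, suppose
`Φ^{ℝ-log}(A)` carries an injective `ℝ_{≥0}`-valued coordinate homomorphism `c` (print: log-divisors read prime
by prime) in which (`hΦ`) `Φ(A)` is `ℚ`-rational at the `ℚ`-type primes `q` [`Φ` perfect: no `ℤ`-type prime],
(`hline`) `ℝ·Φ₀^cnst` cuts out the ray of a direction `d` [the log-divisor of a constant], (`hray`) that ray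
lies in `Φ^{ℝ-log}(A)`, and (`hsat`) its `ℚ`-rational points lie in `Φ(A)` [Def. 2.4 (i)(d) +
group-saturation].  Then (a) holds at `A` as soon as `Φ^{bs-fld}(A) ≠ 0` — conclusion = the type of
`TemperedFrobenioid.isMonoprime_bsFld A` verbatim. [cite: MochizukiEtTh2009, Rmk 3.6.6 p.79] -/
theorem isMonoprime_bsFld_of_coordinates {ι : Type*} (q : ι → Prop) (d : ι → ℝ≥0)
    (c : (T.ΦR.obj (op (base.obj (unop A))) : Type w) →* Multiplicative (ι → ℝ≥0))
    (hc : Function.Injective c)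
    (hΦ : ∀ x ∈ Φ.carrier A, ∀ i, q i → ∃ r : ℚ≥0, (r : ℝ≥0) = Multiplicative.toAdd (c x) i)
    (hline : ∀ x : T.ΦR.obj (op (base.obj (unop A))),
      Algebra.GrothendieckGroup.of x ∈ T.cnstR (op (base.obj (unop A))) ↔
        ∃ t : ℝ≥0, Multiplicative.toAdd (c x) = t • d)
    (hray : ∀ t : ℝ≥0, ∃ x : T.ΦR.obj (op (base.obj (unop A))), Multiplicative.toAdd (c x) = t • d)
    (hsat : ∀ (x : T.ΦR.obj (op (base.obj (unop A)))) (t : ℝ≥0), Multiplicative.toAdd (c x) = t • d →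
      (∀ i, q i → ∃ r : ℚ≥0, (r : ℝ≥0) = t * d i) → x ∈ Φ.carrier A)
    (hne : Φ.carrier A ⊓ (T.cnstR (op (base.obj (unop A)))).toSubmonoid.comap
      Algebra.GrothendieckGroup.of ≠ ⊥) :
    IsMonoprime ↥(Φ.carrier A ⊓ (T.cnstR (op (base.obj (unop A)))).toSubmonoid.comap
      Algebra.GrothendieckGroup.of) :=
  EtaleTheta.Rmk366.isMonoprime_of_coordinates q d c (Φ.carrier A) _ hc hΦ
    (fun x => ⟨fun h => ⟨h.1, (hline x).mp h.2⟩, fun h => ⟨h.1, (hline x).mpr h.2⟩⟩)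
    hray hsat hne

/-- The same in `Φ^{bs-fld}` currency for a tempered Frobenioid `C` (whose record CARRIES (a)): (a) at `A` is
RE-DERIVED from `Φ^{bs-fld}(A) ≠ 0` without the field `C.isMonoprime_bsFld` — the redundancy asserted by
Remark 3.6.6, at print's divisorial reading. [cite: MochizukiEtTh2009, Rmk 3.6.6 p.79] -/
theorem isMonoprime_bsFld_of_coordinates' {VD : FrdICatStub.{u, v, w} D} (C : TemperedFrobenioid T D VD)
    {ι : Type*} (q : ι → Prop) (d : ι → ℝ≥0)
    (c : (T.ΦR.obj (C.baseOp A) : Type w) →* Multiplicative (ι → ℝ≥0)) (hc : Function.Injective c)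
    (hΦ : ∀ x ∈ C.Φ.carrier A, ∀ i, q i → ∃ r : ℚ≥0, (r : ℝ≥0) = Multiplicative.toAdd (c x) i)
    (hline : ∀ x : T.ΦR.obj (C.baseOp A),
      Algebra.GrothendieckGroup.of x ∈ T.cnstR (C.baseOp A) ↔ ∃ t : ℝ≥0, Multiplicative.toAdd (c x) = t • d)
    (hray : ∀ t : ℝ≥0, ∃ x : T.ΦR.obj (C.baseOp A), Multiplicative.toAdd (c x) = t • d)
    (hsat : ∀ (x : T.ΦR.obj (C.baseOp A)) (t : ℝ≥0), Multiplicative.toAdd (c x) = t • d →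
      (∀ i, q i → ∃ r : ℚ≥0, (r : ℝ≥0) = t * d i) → x ∈ C.Φ.carrier A)
    (hne : C.bsFld.carrier A ≠ ⊥) : IsMonoprime ↥(C.bsFld.carrier A) :=
  isMonoprime_bsFld_of_coordinates T C.base C.Φ A q d c hc hΦ hline hray hsat hne

/-! ### v2 (append): print's hypothesis (b) -/

/-- **From print's (b) to the bracketed hypothesis** (Remark 3.6.6, the «one more coordinate step»).  For the
data of Def. 3.6 (i)/(ii) without (a): if `Φ(A)` is group-saturated in `Φ^{ℝ-log}(A)` (Def. 3.6 (ii)) and the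
line `ℝ·Φ₀^cnst` is ORDERED relative to `Φ^{ℝ-log}(A)` (`hlin`: whenever `x/y ∈ ℝ·Φ₀^cnst`, one of `x/y`, `y/x`
is an EFFECTIVE element `z` of `ℝ·Φ₀^cnst` — in print, `x − y = t·d` with `t ∈ ℝ`, and `|t|·d ≥ 0`), then a
pair `x ≠ y` in `Φ(A)` with `x/y ∈ ℝ·Φ₀^cnst` — which is what (b) «`F(A) → (Φ^{bs-fld})^gp(A)` is nonzero»
provides (`exists_FΛ_div_ne` with `divΛ_mem_cnstR`) — yields `Φ^{bs-fld}(A) ≠ 0`.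
[cite: MochizukiEtTh2009, Rmk 3.6.6 p.79] -/
theorem inf_comap_cnstR_ne_bot_of_div_mem (hsatΦ : IsGroupSaturated (Φ.carrier A))
    (hlin : ∀ x y : T.ΦR.obj (op (base.obj (unop A))),
      Algebra.GrothendieckGroup.of x / Algebra.GrothendieckGroup.of y ∈ T.cnstR (op (base.obj (unop A))) →
        ∃ z : T.ΦR.obj (op (base.obj (unop A))),
          Algebra.GrothendieckGroup.of z ∈ T.cnstR (op (base.obj (unop A))) ∧ (x = y * z ∨ y = x * z))
    (hb : ∃ x ∈ Φ.carrier A, ∃ y ∈ Φ.carrier A, x ≠ y ∧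
      Algebra.GrothendieckGroup.of x / Algebra.GrothendieckGroup.of y ∈ T.cnstR (op (base.obj (unop A)))) :
    Φ.carrier A ⊓ (T.cnstR (op (base.obj (unop A)))).toSubmonoid.comap Algebra.GrothendieckGroup.of ≠ ⊥ := by
  obtain ⟨x, hx, y, hy, hxy, hdiv⟩ := hb
  obtain ⟨z, hz, h⟩ := hlin x y hdiv
  have key : ∀ {a b : T.ΦR.obj (op (base.obj (unop A)))}, a ∈ Φ.carrier A → b ∈ Φ.carrier A → a ≠ b →
      a = b * z → Φ.carrier A ⊓ (T.cnstR (op (base.obj (unop A)))).toSubmonoid.comap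
        Algebra.GrothendieckGroup.of ≠ ⊥ := by
    intro a b ha hb hab habz hbot
    have hzΦ : z ∈ Φ.carrier A :=
      (isGroupSaturated_iff' _).1 hsatΦ z a ha b hb (by rw [mul_comm]; exact habz.symm)
    have hz1 : z = 1 := (Submonoid.eq_bot_iff_forall _).mp hbot z ⟨hzΦ, hz⟩
    exact hab (by rw [habz, hz1, mul_one])
  rcases h with h | h
  · exact key hx hy hxy h
  · exact key hy hx (Ne.symm hxy) h

/-- **Remark 3.6.6 with print's hypothesis (b), for a tempered Frobenioid `C`** (whose record carries (b) as
`exists_FΛ_div_ne` and `F₀^Λ → ℝ·Φ₀^cnst` as `divΛ_mem_cnstR`): if the line `ℝ·Φ₀^cnst` is ordered relative to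
`Φ^{ℝ-log}(A)` (`hlin`), then `Φ^{bs-fld}(A) ≠ 0` — so that, in a `Λ`-rational coordinate chart
(`isMonoprime_bsFld_of_coordinates'`), (a) at `A` is re-derived from (b).
[cite: MochizukiEtTh2009, Rmk 3.6.6 p.79] -/
theorem bsFld_ne_bot_of_lineOrdered {VD : FrdICatStub.{u, v, w} D} (C : TemperedFrobenioid T D VD)
    (hlin : ∀ x y : T.ΦR.obj (C.baseOp A),
      Algebra.GrothendieckGroup.of x / Algebra.GrothendieckGroup.of y ∈ T.cnstR (C.baseOp A) →
        ∃ z : T.ΦR.obj (C.baseOp A),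
          Algebra.GrothendieckGroup.of z ∈ T.cnstR (C.baseOp A) ∧ (x = y * z ∨ y = x * z)) :
    C.bsFld.carrier A ≠ ⊥ := by
  obtain ⟨b, hb, x, hx, y, hy, hxy, hdiv⟩ := C.exists_FΛ_div_ne A
  exact inf_comap_cnstR_ne_bot_of_div_mem T C.base C.Φ A (C.isGroupSaturated A) hlin
    ⟨x, hx, y, hy, hxy, hdiv ▸ T.divΛ_mem_cnstR _ b hb⟩

/-- **(b) ⇒ (a) at `A`** for a tempered Frobenioid in a `Λ`-rational coordinate chart with ordered constant
line: the statement of Remark 3.6.6 as printed («condition (a) follows from condition (b)»), at print's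
divisorial reading, WITHOUT the field `C.isMonoprime_bsFld`. [cite: MochizukiEtTh2009, Rmk 3.6.6 p.79] -/
theorem isMonoprime_bsFld_of_coordinates_of_b {VD : FrdICatStub.{u, v, w} D} (C : TemperedFrobenioid T D VD)
    {ι : Type*} (q : ι → Prop) (d : ι → ℝ≥0)
    (c : (T.ΦR.obj (C.baseOp A) : Type w) →* Multiplicative (ι → ℝ≥0)) (hc : Function.Injective c)
    (hΦ : ∀ x ∈ C.Φ.carrier A, ∀ i, q i → ∃ r : ℚ≥0, (r : ℝ≥0) = Multiplicative.toAdd (c x) i)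
    (hline : ∀ x : T.ΦR.obj (C.baseOp A),
      Algebra.GrothendieckGroup.of x ∈ T.cnstR (C.baseOp A) ↔ ∃ t : ℝ≥0, Multiplicative.toAdd (c x) = t • d)
    (hray : ∀ t : ℝ≥0, ∃ x : T.ΦR.obj (C.baseOp A), Multiplicative.toAdd (c x) = t • d)
    (hsat : ∀ (x : T.ΦR.obj (C.baseOp A)) (t : ℝ≥0), Multiplicative.toAdd (c x) = t • d →
      (∀ i, q i → ∃ r : ℚ≥0, (r : ℝ≥0) = t * d i) → x ∈ C.Φ.carrier A)
    (hlin : ∀ x y : T.ΦR.obj (C.baseOp A),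
      Algebra.GrothendieckGroup.of x / Algebra.GrothendieckGroup.of y ∈ T.cnstR (C.baseOp A) →
        ∃ z : T.ΦR.obj (C.baseOp A),
          Algebra.GrothendieckGroup.of z ∈ T.cnstR (C.baseOp A) ∧ (x = y * z ∨ y = x * z)) :
    IsMonoprime ↥(C.bsFld.carrier A) :=
  isMonoprime_bsFld_of_coordinates' T A C q d c hc hΦ hline hray hsat (bsFld_ne_bot_of_lineOrdered T A C hlin)

end Rmk366

end TemperedFrobenioid

end Literature.AnabelianGeometry.EtaleTheta
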